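import Literature.Analysis.FluidPDE.SpaceTimeMollifier
import Literature.Analysis.FluidPDE.HessianLaplacian
import Literature.Analysis.FluidPDE.PressurePoisson
import HarnessLib

/-!
# Calculus of cut-off products of scalar space–time fields

Analysis/FluidPDE support file for the discharge of the named fact
`Literature.Analysis.FluidPDE.NSBoundedInteriorContinuity` (`NSBoundedInteriorRegularity.lean`;
Seregin–Šverák 2009, §2). The duality argument tests the Navier–Stokes momentum equation with
the vector field `ψ = (φ η) c` and the pressure equation with the scalar `ϑ = φ Ξ`, where `φ` is
a space–time cut-off (a test function on the cylinder) and `η`, `Ξ` are jointly smooth scalar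
fields (backward caloric Duhamel integrals), `c` a constant vector. This file records the
elementary expansions used there, all proved:

* closure: `φ H` is a space–time test function on `Q` when `φ` is and `H` is jointly smooth
  (`IsSpaceTimeTestOn.mul_smooth`), and so is `θ • c` (`IsSpaceTimeTestOn.smul_const'`);
* Leibniz rules: `∂ₜ(φH) = ∂ₜφ H + φ ∂ₜH` (`timeDeriv_mul`), the real second-order rule
  `∂ᵤ∂ᵤ(fk) = (∂ᵤ∂ᵤf)k + 2∂ᵤf∂ᵤk + f∂ᵤ∂ᵤk` (`fderiv_fderiv_mul_apply_real`), and its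
  curried form `D²(fk)(u,u)` (`fderiv_fderiv_mul_apply_apply`);
* the four terms of the momentum integrand for `ψ(t) = (φ(t)η(t)) • c`:
  `∂ₜψ`, `(u·∇)ψ`, `Δψ`, `div ψ` (`timeDeriv_mulSmul`, `convect_mulSmul`, `laplacian_mulSmul`,
  `divergence_mulSmul`), combining the tree's `timeDeriv/convect/laplacian/divergence_smul_const`
  (`SpaceTimeMollifier.lean`) with the Leibniz rules (`HessianLaplacian.laplacian_mul_eq`);
* `Dh(x)(u) = ∑ᵢ ⟪u, eᵢ⟫ ∂ᵢh(x)` along an orthonormal basis (`fderiv_apply_eq_sum_inner`).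
-/

noncomputable section

open MeasureTheory Set Function Filter TopologicalSpace
open scoped Topology RealInnerProductSpace Laplacian

namespace Literature.Analysis.FluidPDE

section General

variable {E : Type*} [NormedAddCommGroup E] [InnerProductSpace ℝ E] [FiniteDimensional ℝ E]
variable {F : Type*} [NormedAddCommGroup F] [InnerProductSpace ℝ F]

/-! ### Closure properties -/

omit [FiniteDimensional ℝ E] in
/-- **Cut-off of a smooth field**: if `φ` is a space–time test function on `Q` and `H` is jointly
smooth on `ℝ × E`, then `φ H` is a space–time test function on `Q`. [folklore] -/
theorem IsSpaceTimeTestOn.mul_smooth {Q : Opens (ℝ × E)} {φ H : ℝ → E → ℝ}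
    (hφ : IsSpaceTimeTestOn Q φ) (hH : ContDiff ℝ ((⊤ : ℕ∞) : WithTop ℕ∞) (uncurry H)) :
    IsSpaceTimeTestOn Q (fun t x => φ t x * H t x) where
  contDiff := by
    have : uncurry (fun t x => φ t x * H t x) = fun z : ℝ × E => uncurry φ z * uncurry H z := rfl
    rw [this]
    exact hφ.contDiff.mul hH
  hasCompactSupport := by
    have : uncurry (fun t x => φ t x * H t x) = fun z : ℝ × E => uncurry φ z * uncurry H z := rfl
    rw [this]
    exact hφ.hasCompactSupport.mul_right
  tsupport_subset := by
    have : uncurry (fun t x => φ t x * H t x) = fun z : ℝ × E => uncurry φ z * uncurry H z := rfl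
    rw [this]
    exact (tsupport_mul_subset_left).trans hφ.tsupport_subset

omit [FiniteDimensional ℝ E] in
/-- **A scalar test function times a constant vector is a test field.** [folklore] -/
theorem IsSpaceTimeTestOn.smul_const' {Q : Opens (ℝ × E)} {θ : ℝ → E → ℝ}
    (hθ : IsSpaceTimeTestOn Q θ) (c : F) :
    IsSpaceTimeTestOn Q (fun t x => θ t x • c) where
  contDiff := by
    have : uncurry (fun t x => θ t x • c) = fun z : ℝ × E => uncurry θ z • c := rfl
    rw [this]
    exact hθ.contDiff.smul contDiff_const
  hasCompactSupport := by
    have : uncurry (fun t x => θ t x • c) = fun z : ℝ × E => uncurry θ z • c := rfl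
    rw [this]
    exact hθ.hasCompactSupport.smul_right
  tsupport_subset := by
    have : uncurry (fun t x => θ t x • c) = fun z : ℝ × E => uncurry θ z • c := rfl
    rw [this]
    exact (tsupport_smul_subset_left (uncurry θ) fun _ => c).trans hθ.tsupport_subset

/-! ### Joint smoothness: slices and partial differentiability -/

omit [FiniteDimensional ℝ E] in
/-- Slices in `x` of a jointly smooth field are smooth. [folklore] -/
theorem contDiff_slice_of_uncurry {H : ℝ → E → ℝ} {n : WithTop ℕ∞} (hH : ContDiff ℝ n (uncurry H))
    (t : ℝ) : ContDiff ℝ n (H t) :=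
  hH.comp (contDiff_prodMk_right t)

omit [FiniteDimensional ℝ E] in
/-- Slices in `t` of a jointly smooth field are differentiable. [folklore] -/
theorem differentiableAt_time_of_uncurry {H : ℝ → E → ℝ} {n : WithTop ℕ∞}
    (hH : ContDiff ℝ n (uncurry H)) (hn : n ≠ 0) (t : ℝ) (x : E) :
    DifferentiableAt ℝ (fun s => H s x) t :=
  ((hH.comp (contDiff_prodMk_left x)).differentiable hn).differentiableAt

/-! ### Leibniz rules -/

omit [NormedAddCommGroup E] [InnerProductSpace ℝ E] [FiniteDimensional ℝ E] in
/-- **`∂ₜ(φH) = ∂ₜφ · H + φ · ∂ₜH`** at points of time differentiability. [folklore] -/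
theorem timeDeriv_mul {E : Type*} {φ H : ℝ → E → ℝ} {t : ℝ} {x : E}
    (hφ : DifferentiableAt ℝ (fun s => φ s x) t) (hH : DifferentiableAt ℝ (fun s => H s x) t) :
    timeDeriv (fun s y => φ s y * H s y) t x = timeDeriv φ t x * H t x + φ t x * timeDeriv H t x := by
  simp only [timeDeriv_apply]
  exact deriv_fun_mul hφ hH

omit [FiniteDimensional ℝ E] in
/-- **Second directional derivative of a product of real `C²` functions**:
`∂ᵤ∂ᵤ(fk) = (∂ᵤ∂ᵤf) k + 2 ∂ᵤf ∂ᵤk + f ∂ᵤ∂ᵤk`. [folklore] -/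
theorem fderiv_fderiv_mul_apply_real {f k : E → ℝ} (hf : ContDiff ℝ 2 f) (hk : ContDiff ℝ 2 k)
    (u : E) (x : E) :
    fderiv ℝ (fun y => fderiv ℝ (fun z => f z * k z) y u) x u =
      fderiv ℝ (fun y => fderiv ℝ f y u) x u * k x + 2 * (fderiv ℝ f x u * fderiv ℝ k x u) +
        f x * fderiv ℝ (fun y => fderiv ℝ k y u) x u := by
  have hf1 : Differentiable ℝ f := hf.differentiable (by norm_num)
  have hk1 : Differentiable ℝ k := hk.differentiable (by norm_num)
  have hf' : Differentiable ℝ (fun y => fderiv ℝ f y u) :=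
    ((hf.fderiv_right (m := 1) (by norm_num)).clm_apply contDiff_const).differentiable one_ne_zero
  have hk' : Differentiable ℝ (fun y => fderiv ℝ k y u) :=
    ((hk.fderiv_right (m := 1) (by norm_num)).clm_apply contDiff_const).differentiable one_ne_zero
  have h1 : (fun y => fderiv ℝ (fun z => f z * k z) y u) =
      fun y => fderiv ℝ f y u * k y + f y * fderiv ℝ k y u := by
    funext y
    rw [fderiv_fun_mul (hf1 y) (hk1 y)]
    simp only [_root_.add_apply, FunLike.coe_smul, Pi.smul_apply,
      smul_eq_mul]
    ring
  rw [h1, fderiv_fun_add ((hf' x).fun_mul (hk1 x)) ((hf1 x).fun_mul (hk' x)),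
    _root_.add_apply, fderiv_fun_mul (hf' x) (hk1 x), fderiv_fun_mul (hf1 x) (hk' x)]
  simp only [_root_.add_apply, FunLike.coe_smul, Pi.smul_apply, smul_eq_mul]
  ring

omit [FiniteDimensional ℝ E] in
/-- The curried form: **`D²(fk)(x)(u, u) = (D²f(u,u)) k + 2 Df(u) Dk(u) + f D²k(u,u)`** with the
second derivative of `k` in nested form. [folklore] -/
theorem fderiv_fderiv_mul_apply_apply {f k : E → ℝ} (hf : ContDiff ℝ 2 f) (hk : ContDiff ℝ 2 k)
    (x u : E) :
    fderiv ℝ (fderiv ℝ (fun z => f z * k z)) x u u =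
      fderiv ℝ (fderiv ℝ f) x u u * k x + 2 * (fderiv ℝ f x u * fderiv ℝ k x u) +
        f x * fderiv ℝ (fun y => fderiv ℝ k y u) x u := by
  have hfk : ContDiff ℝ 2 (fun z => f z * k z) := hf.mul hk
  have hD : DifferentiableAt ℝ (fderiv ℝ (fun z => f z * k z)) x :=
    ((hfk.fderiv_right (m := 1) le_rfl).differentiable one_ne_zero) x
  have hDf : DifferentiableAt ℝ (fderiv ℝ f) x :=
    ((hf.fderiv_right (m := 1) le_rfl).differentiable one_ne_zero) x
  rw [← fderiv_apply_const_apply hD u u, ← fderiv_apply_const_apply hDf u u]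
  exact fderiv_fderiv_mul_apply_real hf hk u x

omit [FiniteDimensional ℝ E] in
/-- **`Dh(x)(u) = ∑ᵢ ⟪u, eᵢ⟫ ∂ᵢh(x)`** along an orthonormal basis. [folklore] -/
theorem fderiv_apply_eq_sum_inner {ι : Type*} [Fintype ι] (b : OrthonormalBasis ι ℝ E)
    (h : E → ℝ) (x u : E) :
    fderiv ℝ h x u = ∑ i, ⟪u, b i⟫ * fderiv ℝ h x (b i) := by
  conv_lhs => rw [← b.sum_repr' u]
  rw [map_sum]
  refine Finset.sum_congr rfl fun i _ => ?_
  rw [map_smul, smul_eq_mul, real_inner_comm]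

/-! ### The momentum integrand for `ψ = (φη) • c` -/

variable {φ η : ℝ → E → ℝ}

omit [FiniteDimensional ℝ E] in
/-- `∂ₜ((φη)c) = (∂ₜφ η + φ ∂ₜη) c`. [folklore] -/
theorem timeDeriv_mulSmul (hφ : ContDiff ℝ ((⊤ : ℕ∞) : WithTop ℕ∞) (uncurry φ))
    (hη : ContDiff ℝ ((⊤ : ℕ∞) : WithTop ℕ∞) (uncurry η)) (c : F) (t : ℝ) (x : E) :
    timeDeriv (fun s y => (φ s y * η s y) • c) t x =
      (timeDeriv φ t x * η t x + φ t x * timeDeriv η t x) • c := by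
  have h1 := differentiableAt_time_of_uncurry hφ (by simp) t x
  have h2 := differentiableAt_time_of_uncurry hη (by simp) t x
  rw [timeDeriv_smul_const (fun s y => φ s y * η s y) c (h1.mul h2), timeDeriv_mul h1 h2]

omit [FiniteDimensional ℝ E] in
/-- `(u·∇)((φη)c) = (Dφ(u) η + φ Dη(u)) c`. [folklore] -/
theorem convect_mulSmul (hφ : ContDiff ℝ ((⊤ : ℕ∞) : WithTop ℕ∞) (uncurry φ))
    (hη : ContDiff ℝ ((⊤ : ℕ∞) : WithTop ℕ∞) (uncurry η)) (c : F) (u : E → E) (t : ℝ) (x : E) :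
    convect u (fun y => (φ t y * η t y) • c) x =
      (fderiv ℝ (φ t) x (u x) * η t x + φ t x * fderiv ℝ (η t) x (u x)) • c := by
  have hφd : DifferentiableAt ℝ (φ t) x :=
    ((contDiff_slice_of_uncurry hφ t).differentiable (by simp)) x
  have hηd : DifferentiableAt ℝ (η t) x :=
    ((contDiff_slice_of_uncurry hη t).differentiable (by simp)) x
  rw [convect_smul_const u c (hφd.fun_mul hηd), fderiv_fun_mul hφd hηd]
  simp only [_root_.add_apply, FunLike.coe_smul, Pi.smul_apply, smul_eq_mul]
  congr 1; ring

/-- `Δ((φη)c) = (φ Δη + η Δφ + 2 ∑ᵢ ∂ᵢφ ∂ᵢη) c`. [folklore] -/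
theorem laplacian_mulSmul {ι : Type*} [Fintype ι] (b : OrthonormalBasis ι ℝ E)
    (hφ : ContDiff ℝ ((⊤ : ℕ∞) : WithTop ℕ∞) (uncurry φ))
    (hη : ContDiff ℝ ((⊤ : ℕ∞) : WithTop ℕ∞) (uncurry η)) (c : F) (t : ℝ) (x : E) :
    (Δ (fun y => (φ t y * η t y) • c)) x =
      (φ t x * (Δ (η t)) x + η t x * (Δ (φ t)) x +
        2 * ∑ i, fderiv ℝ (φ t) x (b i) * fderiv ℝ (η t) x (b i)) • c := by
  have hφ2 : ContDiff ℝ 2 (φ t) := (contDiff_slice_of_uncurry hφ t).of_le two_le_infty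
  have hη2 : ContDiff ℝ 2 (η t) := (contDiff_slice_of_uncurry hη t).of_le two_le_infty
  rw [laplacian_smul_const (hφ2.mul hη2) c x, laplacian_mul_eq b hφ2 hη2 x]

/-- `div ((φη)c) = ∂_cφ η + φ ∂_cη` (here `F = E`). [folklore] -/
theorem divergence_mulSmul (hφ : ContDiff ℝ ((⊤ : ℕ∞) : WithTop ℕ∞) (uncurry φ))
    (hη : ContDiff ℝ ((⊤ : ℕ∞) : WithTop ℕ∞) (uncurry η)) (c : E) (t : ℝ) (x : E) :
    VectorCalculus.divergence (fun y => (φ t y * η t y) • c) x =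
      fderiv ℝ (φ t) x c * η t x + φ t x * fderiv ℝ (η t) x c := by
  have hφd : DifferentiableAt ℝ (φ t) x :=
    ((contDiff_slice_of_uncurry hφ t).differentiable (by simp)) x
  have hηd : DifferentiableAt ℝ (η t) x :=
    ((contDiff_slice_of_uncurry hη t).differentiable (by simp)) x
  rw [divergence_smul_const c (hφd.fun_mul hηd), fderiv_fun_mul hφd hηd]
  simp only [_root_.add_apply, FunLike.coe_smul, Pi.smul_apply, smul_eq_mul]
  ring

/-! ### The pressure integrand for `ϑ = φΞ` -/

omit [FiniteDimensional ℝ E] in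
/-- `D²(φΞ)(u,u) = φ D²Ξ(u,u) + Ξ D²φ(u,u) + 2 Dφ(u) DΞ(u)` (curried Hessians of `φΞ` and `φ`,
nested for `Ξ`). [folklore] -/
theorem hessian_mul_apply_apply {φ' Ξ : E → ℝ} (hφ : ContDiff ℝ 2 φ') (hΞ : ContDiff ℝ 2 Ξ)
    (x u : E) :
    fderiv ℝ (fderiv ℝ (fun z => φ' z * Ξ z)) x u u =
      φ' x * fderiv ℝ (fun y => fderiv ℝ Ξ y u) x u +
        Ξ x * fderiv ℝ (fderiv ℝ φ') x u u + 2 * (fderiv ℝ φ' x u * fderiv ℝ Ξ x u) := by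
  rw [fderiv_fderiv_mul_apply_apply hφ hΞ x u]; ring

-- `Δ(φΞ) = φ ΔΞ + Ξ Δφ + 2 ∑ᵢ ∂ᵢφ ∂ᵢΞ` is `laplacian_mul_eq` (`HessianLaplacian.lean`); the former
-- restatement `laplacian_mul_apply` was removed as a duplicate (dedup-00117, 2026-08-15).

end General

end Literature.Analysis.FluidPDE
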